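import Mathlib
import HarnessLib
import Literature.NumberTheory.GaloisRepresentations.OrdinaryGaloisRep
import Literature.NumberTheory.GaloisRepresentations.DecompositionGroupOfCompletion
import Summits.Langlands.Langlands.Theorems.SkinnerWilesDefectOneEisensteinProModularSeedRestrictTwistGaloisPackageAux2

/-!
# `EisensteinProModularSeed` (stmt-Langlands-12920), line `descend-raise-basechange` (v3), stub S0
# `stub_distinguishedDescendsQ` — `p`-distinguishedness descends to `ℚ`

Support file (`--supports stmt-Langlands-12920`).  Everything here is PROVED (no named fact, no
definition).

Setting: `F` a number field, `p` a prime, `O = 𝒪_{ℚ̄_p}` the valuation ring of `ℚ̄_p = PadicAlgCl p`,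
`ρ : Γ_F → GL₂(ℚ̄_p)` continuous with a residually upper-triangular integral model `ρ₀ : Γ_F → GL₂(O)`
(ordered residual diagonal `(χ̄_a, χ̄_b)`), `p`-DISTINGUISHED at every `v ∣ p`
(`IsPDistinguishedAt ρ₀ v`: some `σ₀ ∈ Γ_{F_v}` has `χ̄_a(σ₀) ≠ χ̄_b(σ₀)`), and a unit-valued
`η : Γ_ℚ → ℚ̄_pˣ` with the DESCENT relation `η̄(σ|_ℚ) χ̄_a(σ) = χ̄_b(σ)` on `Γ_F`.

* `stub_distinguishedDescendsQ` — at the place `w ∋ p` of `ℚ` there are a prime `𝔓 ∣ w` of `\bar ℤ`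
  and an element `σ` of its decomposition group (`σ 𝔓 ⊆ 𝔓`) with `η̄(σ) ≠ 1`.

Proof: choose `v ∣ w` in `F` (lying over, `𝓞 F / 𝓞 ℚ` integral), a distinguished `σ₀ ∈ Γ_{F_v}` and
`g = res σ₀ ∈ Γ_F`.  If `η̄(g|_ℚ) = 1` then DESCENT gives `χ̄_a(g) = χ̄_b(g)` (ultrametric inequality in
`ℚ̄_p`), contradicting distinguishedness; and `g` stabilises the prime `𝔓₀(F, v)` of the chosen
embedding (`decompositionSubgroup_adicCompletionPrime_eq_range`), so `g|_ℚ` stabilises the prime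
`ι⁻¹ 𝔓₀(F, v)` of `\bar ℤ` above `w` (`RestrictTwist.exists_primesAbove_restrict_decomp`).

References: J. Neukirch, *Algebraic Number Theory* (1999), Ch. I §9, Ch. II §9 Prop. (9.6);
C. Skinner, A. Wiles, *Residually reducible representations and modular forms*, Publ. IHÉS 89 (1999),
§1 (the hypothesis `(χ̄₁/χ̄₂)|_{D_p} ≠ 1`). [folklore]
-/

set_option linter.dupNamespace false -- project-wide option (lakefile weak.linter.dupNamespace); `Summit.Langlands.Langlands` is the mandated namespace

noncomputable section

namespace Summit.Langlands.Langlands.Theorems.SkinnerWilesDefectOne.EisensteinProModularSeed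

open Literature.NumberTheory.GaloisRepresentations
open NumberField IsDedekindDomain IsLocalRing Field
open scoped Pointwise

section Helpers

variable {p : ℕ} [Fact p.Prime]

/-- Ultrametric bookkeeping in `ℚ̄_p`: if `v(e a - d) < 1`, `v(e - 1) < 1` and `v(a) ≤ 1` then
`v(a - d) < 1` (`a - d = (e a - d) - (e - 1) a`). [folklore] -/
theorem v_sub_lt_one_of_v_mul_sub_lt_one {e a d : PadicAlgCl p}
    (h : Valued.v (e * a - d) < 1) (he : Valued.v (e - 1) < 1) (ha : Valued.v a ≤ 1) :
    Valued.v (a - d) < 1 := by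
  have e1 : a - d = (e * a - d) - (e - 1) * a := by ring
  rw [e1]
  refine lt_of_le_of_lt (Valuation.map_sub _ _ _) (max_lt h ?_)
  rw [map_mul]
  exact mul_lt_one_of_nonneg_of_lt_one_left zero_le he ha

variable {F : Type} [Field F] [NumberField F]

/-- A finite place of the number field `F` above a given finite place `w` of `ℚ` (lying over for the
integral extension `𝓞 ℚ ⊆ 𝓞 F`). [folklore] -/
theorem exists_heightOneSpectrum_over (w : HeightOneSpectrum (𝓞 ℚ)) :
    ∃ v : HeightOneSpectrum (𝓞 F), v.asIdeal.under (𝓞 ℚ) = w.asIdeal := by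
  obtain ⟨Q, hQmax, hQ⟩ := Ideal.exists_ideal_over_maximal_of_isIntegral (S := 𝓞 F) w.asIdeal
    (by rw [NumberField.RingOfIntegers.ker_algebraMap_eq_bot]; exact bot_le)
  refine ⟨⟨Q, hQmax.isPrime, fun h => w.ne_bot ?_⟩, hQ⟩
  rw [← hQ, h, Ideal.comap_bot_of_injective _ (NumberField.RingOfIntegers.algebraMap.injective ℚ F)]

end Helpers

/-- **STUB S0 — `p`-distinguishedness descends to `ℚ`.**  For a residually upper-triangular integral
model `ρ₀` of a continuous `ρ : Γ_F → GL₂(ℚ̄_p)`, `p`-distinguished at every `v ∣ p`, and a unit-valued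
`η : Γ_ℚ → ℚ̄_pˣ` with the DESCENT relation `η̄(σ|_ℚ) χ̄_a(σ) = χ̄_b(σ)`: at the place `w ∋ p` of `ℚ`
there are a prime `𝔓 ∣ w` of `\bar ℤ` and an element `σ` of its decomposition group (`σ 𝔓 ⊆ 𝔓`) with
`η̄(σ) ≠ 1` (registered signature of skeleton v3, verbatim).  Neukirch, *Algebraic Number Theory*,
Ch. II §9 Prop. (9.6); Skinner–Wiles (1999), §1. [folklore] -/
theorem stub_distinguishedDescendsQ :
    ∀ (F : Type) [Field F] [NumberField F] (p : ℕ) [Fact p.Prime] (O : ValuationSubring (PadicAlgCl p)),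
      O = (Valued.v : Valuation (PadicAlgCl p) NNReal).valuationSubring →
      ∀ (ρ : Literature.NumberTheory.GaloisRepresentations.FramedGaloisRep F (PadicAlgCl p) 2)
        (ρ₀ : Field.absoluteGaloisGroup F →* Matrix.GeneralLinearGroup (Fin 2) O),
      ρ.HasUpperTriangularIntegralModel ρ₀ →
      (∀ v : IsDedekindDomain.HeightOneSpectrum (NumberField.RingOfIntegers F), (p : NumberField.RingOfIntegers F) ∈ v.asIdeal →
        Literature.NumberTheory.GaloisRepresentations.IsPDistinguishedAt ρ₀ v) →
      ∀ (η : Field.absoluteGaloisGroup ℚ →ₜ* (PadicAlgCl p)ˣ),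
      (∀ τ, Valued.v ((η τ : (PadicAlgCl p)ˣ) : PadicAlgCl p) = 1) →
      (∀ σ : Field.absoluteGaloisGroup F,
        Valued.v (((η (Literature.NumberTheory.GaloisRepresentations.absGaloisRestrict ℚ F σ) : (PadicAlgCl p)ˣ) : PadicAlgCl p) *
            ((ρ₀ σ).val 0 0 : PadicAlgCl p) - ((ρ₀ σ).val 1 1 : PadicAlgCl p)) < 1) →
      ∀ w : IsDedekindDomain.HeightOneSpectrum (NumberField.RingOfIntegers ℚ), (p : NumberField.RingOfIntegers ℚ) ∈ w.asIdeal →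
        ∃ 𝔓 ∈ w.primesAbove, ∃ σ : Field.absoluteGaloisGroup ℚ, (∀ x ∈ 𝔓, σ • x ∈ 𝔓) ∧
          ¬ Valued.v (((η σ : (PadicAlgCl p)ˣ) : PadicAlgCl p) - 1) < 1 := by
  intro F _ _ p _ O hO ρ ρ₀ _hmod hdist η _hunit hdesc w hpw
  -- a place `v ∣ w` of `F`; it divides `p`
  obtain ⟨v, hvw⟩ := exists_heightOneSpectrum_over (F := F) w
  have hpv : (p : 𝓞 F) ∈ v.asIdeal := (RestrictTwist.natCast_mem_under_iff ℚ v p).mp (hvw ▸ hpw)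
  -- a distinguished element of `Γ_{F_v}`
  obtain ⟨σ₀, hσ₀⟩ := (isPDistinguishedAt_iff ρ₀ v).mp (hdist v hpv)
  set g := absGaloisRestrict F (v.adicCompletion F) σ₀ with hg_def
  -- `g` stabilises the prime `𝔓₀(F, v)` of the chosen embedding
  have hg : g • adicCompletionPrime F v = adicCompletionPrime F v :=
    Ideal.mem_decompositionSubgroup_iff.mp
      ((decompositionSubgroup_adicCompletionPrime_eq_range F v).symm ▸ ⟨σ₀, rfl⟩)
  -- transfer to `ℚ`
  obtain ⟨𝔓, h𝔓, hD, -⟩ := RestrictTwist.exists_primesAbove_restrict_decomp ℚ F hvw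
    (adicCompletionPrime_mem_primesAbove F v)
  refine ⟨𝔓, h𝔓, absGaloisRestrict ℚ F g, fun x hx => ?_, fun hlt => hσ₀ ?_⟩
  · have h := Ideal.smul_mem_pointwise_smul (absGaloisRestrict ℚ F g) x 𝔓 hx
    rwa [hD g hg] at h
  · subst hO
    rw [Valuation.mem_maximalIdeal_iff]
    push_cast
    exact v_sub_lt_one_of_v_mul_sub_lt_one (hdesc g) hlt
      ((Valuation.mem_valuationSubring_iff _ _).mp ((ρ₀ g).val 0 0).2)

end Summit.Langlands.Langlands.Theorems.SkinnerWilesDefectOne.EisensteinProModularSeed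

end
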